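import Literature.Analysis.FunctionSpaces.BesselIGeneratingFunction
import Summits.Ventures.LatticeQCDFlow.Scoring.OnePlaquetteEnclosures
import Mathlib.Analysis.SpecificLimits.Basic
import HarnessLib

/-!
# Instrument cell `ym-instrument`, crew (b) (typist tasks L2 / B5(c) of SC-PLAN.md): a kernel-evaluable exact-rational CHECKER for two-sided
# enclosures of the modified Bessel functions `I_n(x)` and of their RATIOS `I_n(x)/I_m(x)` — the SU(2) character activities `v_j = I_{2j+1}/I₁`

QUESTIONS.md rows: Q-B1 / Q-B2 (REGISTERED 2026-08-26T13:54:11Z; A-0826-8); cell `run/shared/lean/pub/ym-instrument/`, HUMAN RULING D-0084 (2), director-ym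
R138; one-plaquette object (no currency row).  HONEST FRAMING (page 1, binding).  WHAT IS CERTIFIED HERE AND AT WHICH `(G, D, L, β)`: NOTHING about any
lattice gauge theory.  This file is pure one-variable analysis: for the tree's integral-defined modified Bessel function
`Literature.Analysis.FunctionSpaces.besselI n x = π⁻¹∫₀^π e^{x cos θ} cos(nθ) dθ` (`= Σ_k (x/2)^{2k+n}/(k!(k+n)!)`, tree `hasSum_besselI`) it proves the
partial-sum bracket `P_K ≤ I_n(x) ≤ P_K + T_K` (`x ≥ 0`; geometric tail `T_K = t_K/(1 − q)`, `q = (x/2)²/((K+1)(K+1+n))`) and packages it as Boolean checkers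
`besselICheck` / `besselRatioCheck` over `ℚ` with soundness theorems, so that an enclosure `lo ≤ I_n(β)/I_m(β) ≤ hi` at rational `β, lo, hi` is decided by
`decide +kernel` (exact rational arithmetic in the kernel; no floating point, no `native_decide`).  USE IN THE CELL: the `SU(2)` strong-coupling CHARACTER
ACTIVITIES `v_j(β_W) = I_{2j+1}(β_W)/I₁(β_W)` (Montvay–Münster §3.4; tree `Scoring.su2CharCoeff_eq_besselI_sub`, `SU2OneLink.integral_exp_mul_chebyshevU_re_trace_eq_besselI_succ`)
— the inputs of the RT-χ radius certificate's activity column `w = Σ_j (2j+1)² v_j` and of the Q-B2(c) tables — and `u = v_{1/2} = I₂/I₁` (companion file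
`StrongCouplingExpansionParameter`, which uses the tree's cos-moment checker instead; the two routes cross-check).  Nothing here is summit-bearing; a Bessel ratio
is not a lattice expectation in `D = 4`, not a mass, not a radius.

Contents: §1 the series term `bTerm`, its ratio recursion and the bracket `besselI_mem_bracket`; §2 the `ℚ`-checkers and `besselICheck_sound`,
`besselRatioCheck_sound`; §3 sample rows `v_j(β_W)`, `j = 1/2, 1, 3/2`, at `β_W = 9/25` and `β_W = 1/10` (width `10⁻¹²`), the table proper being the
companion data file(s) `BesselRatioTable*.lean` built on §2.
-/

noncomputable section

open Real Finset
open scoped Nat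
open Literature.Analysis.FunctionSpaces (besselI hasSum_besselI)
open Summit.Ventures.LatticeQCDFlow.Scoring (psumQ psumQ_eq_sum)

namespace Summit.QuantumFields.YangMills.Theorems.Instrument.BesselRatioEnclosures

/-! ## §1 The power-series bracket of `I_n(x)`, `x ≥ 0` -/

/-- The `k`-th term of the power series of `I_n(x)`: `t_k = (x/2)^{2k+n}/(k!(k+n)!)` (tree `hasSum_besselI`). [folklore] -/
def bTerm (n : ℕ) (x : ℝ) (k : ℕ) : ℝ := (x / 2) ^ (2 * k + n) / ((k ! : ℝ) * ((k + n) ! : ℝ))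

/-- `I_n(x) = Σ_k t_k` (the tree's `hasSum_besselI`, in this file's notation). [cite: DLMF, 10.25.2] -/
theorem hasSum_bTerm (n : ℕ) (x : ℝ) : HasSum (bTerm n x) (besselI n x) := hasSum_besselI n x

/-- The terms are nonnegative for `x ≥ 0`. [folklore] -/
theorem bTerm_nonneg (n : ℕ) {x : ℝ} (hx : 0 ≤ x) (k : ℕ) : 0 ≤ bTerm n x k := by
  unfold bTerm; positivity

/-- **Ratio recursion**: `t_{k+1} = t_k · (x/2)²/((k+1)(k+1+n))`. [folklore] -/
theorem bTerm_succ (n : ℕ) (x : ℝ) (k : ℕ) :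
    bTerm n x (k + 1) = bTerm n x k * ((x / 2) ^ 2 / (((k : ℝ) + 1) * ((k : ℝ) + 1 + n))) := by
  unfold bTerm
  have h1 : ((k + 1)! : ℝ) = ((k : ℝ) + 1) * (k ! : ℝ) := by
    rw [Nat.factorial_succ]; push_cast; ring
  have h2 : ((k + 1 + n)! : ℝ) = ((k : ℝ) + 1 + n) * ((k + n)! : ℝ) := by
    rw [show k + 1 + n = (k + n) + 1 by omega, Nat.factorial_succ]; push_cast; ring
  rw [h1, h2, show 2 * (k + 1) + n = (2 * k + n) + 2 by omega, pow_add]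
  have hk : (0 : ℝ) < (k ! : ℝ) := by exact_mod_cast Nat.factorial_pos k
  have hkn : (0 : ℝ) < ((k + n)! : ℝ) := by exact_mod_cast Nat.factorial_pos (k + n)
  have h3 : (0 : ℝ) < (k : ℝ) + 1 := by positivity
  have h4 : (0 : ℝ) < (k : ℝ) + 1 + n := by positivity
  field_simp

/-- Beyond `K` the term ratios are at most `q` whenever `(x/2)²/((K+1)(K+1+n)) ≤ q`: `t_{K+j} ≤ t_K q^j`. [folklore] -/
theorem bTerm_add_le (n : ℕ) {x q : ℝ} (hx : 0 ≤ x) (K : ℕ)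
    (hq : (x / 2) ^ 2 / (((K : ℝ) + 1) * ((K : ℝ) + 1 + n)) ≤ q) (j : ℕ) :
    bTerm n x (K + j) ≤ bTerm n x K * q ^ j := by
  induction j with
  | zero => simp
  | succ j ih =>
    have hq0 : 0 ≤ q := le_trans (by positivity) hq
    have hratio : (x / 2) ^ 2 / ((((K + j : ℕ) : ℝ) + 1) * ((((K + j : ℕ) : ℝ)) + 1 + n)) ≤ q := by
      refine le_trans ?_ hq
      apply div_le_div_of_nonneg_left (by positivity) (by positivity)
      push_cast
      have hj : (0 : ℝ) ≤ j := Nat.cast_nonneg j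
      have hK : (0 : ℝ) ≤ K := Nat.cast_nonneg K
      have hn : (0 : ℝ) ≤ n := Nat.cast_nonneg n
      nlinarith
    rw [show K + (j + 1) = (K + j) + 1 by omega, bTerm_succ, pow_succ]
    calc bTerm n x (K + j) * ((x / 2) ^ 2 / ((((K + j : ℕ) : ℝ) + 1) * (((K + j : ℕ) : ℝ) + 1 + n)))
        ≤ (bTerm n x K * q ^ j) * q :=
          mul_le_mul ih hratio (by positivity) (mul_nonneg (bTerm_nonneg n hx K) (pow_nonneg hq0 j))
      _ = bTerm n x K * (q ^ j * q) := by ring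

/-- ★ **The bracket.**  For `x ≥ 0`, every `K` and every `q` with `(x/2)²/((K+1)(K+1+n)) ≤ q < 1`:
`Σ_{k<K} t_k ≤ I_n(x) ≤ Σ_{k<K} t_k + t_K/(1 − q)` (nonnegative series; geometric domination of the tail). [folklore] -/
theorem besselI_mem_bracket (n : ℕ) {x q : ℝ} (hx : 0 ≤ x) (K : ℕ)
    (hq : (x / 2) ^ 2 / (((K : ℝ) + 1) * ((K : ℝ) + 1 + n)) ≤ q) (hq1 : q < 1) :
    ∑ k ∈ range K, bTerm n x k ≤ besselI n x ∧
      besselI n x ≤ ∑ k ∈ range K, bTerm n x k + bTerm n x K / (1 - q) := by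
  have h := hasSum_bTerm n x
  have hq0 : 0 ≤ q := le_trans (by positivity) hq
  refine ⟨sum_le_hasSum (range K) (fun k _ => bTerm_nonneg n hx k) h, ?_⟩
  have htail := (hasSum_nat_add_iff' K).2 h
  have hgeo : HasSum (fun j : ℕ => bTerm n x K * q ^ j) (bTerm n x K * (1 - q)⁻¹) :=
    (hasSum_geometric_of_lt_one hq0 hq1).mul_left _
  have hle : ∀ j : ℕ, bTerm n x (j + K) ≤ bTerm n x K * q ^ j := fun j => by
    rw [add_comm]; exact bTerm_add_le n hx K hq j
  have key := hasSum_le hle htail hgeo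
  rw [div_eq_mul_inv]
  linarith

/-! ## §2 The exact-rational checkers and their soundness -/

/-- `ℚ`-version of the series term. -/
def bTermQ (n : ℕ) (x : ℚ) (k : ℕ) : ℚ := (x / 2) ^ (2 * k + n) / ((k ! : ℚ) * ((k + n) ! : ℚ))

/-- `ℚ`-partial sum `P_K = Σ_{k<K} t_k` (structural recursion, kernel-evaluable: the tree's `psumQ`). -/
def bPartialQ (n : ℕ) (x : ℚ) (K : ℕ) : ℚ := psumQ (bTermQ n x) K

/-- The tail ratio `q_K = (x/2)²/((K+1)(K+1+n))`. -/
def bRatioQ (n : ℕ) (x : ℚ) (K : ℕ) : ℚ := (x / 2) ^ 2 / (((K : ℚ) + 1) * ((K : ℚ) + 1 + n))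

/-- The tail bound `T_K = t_K/(1 − q_K)`. -/
def bTailQ (n : ℕ) (x : ℚ) (K : ℕ) : ℚ := bTermQ n x K / (1 - bRatioQ n x K)

/-- Checker for `lo ≤ I_n(x) ≤ hi` with `K` terms. -/
def besselICheck (n : ℕ) (x lo hi : ℚ) (K : ℕ) : Bool :=
  decide (0 ≤ x) && decide (bRatioQ n x K < 1) && decide (lo ≤ bPartialQ n x K) && decide (bPartialQ n x K + bTailQ n x K ≤ hi)

/-- Checker for `lo ≤ I_n(x)/I_m(x) ≤ hi` with `Kn`, `Km` terms (`0 ≤ lo`, `0 ≤ hi`). -/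
def besselRatioCheck (n m : ℕ) (x lo hi : ℚ) (Kn Km : ℕ) : Bool :=
  decide (0 ≤ x) && decide (bRatioQ n x Kn < 1) && decide (bRatioQ m x Km < 1) && decide (0 ≤ lo) && decide (0 ≤ hi) &&
    decide (0 < bPartialQ m x Km) &&
    decide (lo * (bPartialQ m x Km + bTailQ m x Km) ≤ bPartialQ n x Kn) &&
    decide (bPartialQ n x Kn + bTailQ n x Kn ≤ hi * bPartialQ m x Km)

/-- Cast: the `ℚ`-term is the real term. -/
theorem cast_bTermQ (n : ℕ) (x : ℚ) (k : ℕ) : ((bTermQ n x k : ℚ) : ℝ) = bTerm n (x : ℝ) k := by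
  unfold bTermQ bTerm; push_cast; ring

/-- Cast: the `ℚ`-partial sum is the real partial sum. -/
theorem cast_bPartialQ (n : ℕ) (x : ℚ) (K : ℕ) : ((bPartialQ n x K : ℚ) : ℝ) = ∑ k ∈ range K, bTerm n (x : ℝ) k := by
  unfold bPartialQ; rw [psumQ_eq_sum]; push_cast; exact Finset.sum_congr rfl fun k _ => cast_bTermQ n x k

/-- Cast: the `ℚ`-ratio is the real ratio. -/
theorem cast_bRatioQ (n : ℕ) (x : ℚ) (K : ℕ) :
    ((bRatioQ n x K : ℚ) : ℝ) = ((x : ℝ) / 2) ^ 2 / (((K : ℝ) + 1) * ((K : ℝ) + 1 + n)) := by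
  unfold bRatioQ; push_cast; ring

/-- The real bracket at a rational point, in checker variables: `P_K ≤ I_n(x) ≤ P_K + T_K`. [folklore] -/
theorem bracket_cast (n : ℕ) {x : ℚ} (hx : 0 ≤ x) {K : ℕ} (hq : bRatioQ n x K < 1) :
    ((bPartialQ n x K : ℚ) : ℝ) ≤ besselI n (x : ℝ) ∧
      besselI n (x : ℝ) ≤ ((bPartialQ n x K : ℚ) : ℝ) + ((bTailQ n x K : ℚ) : ℝ) := by
  have hx' : (0 : ℝ) ≤ (x : ℝ) := by exact_mod_cast hx
  have hq' : ((x : ℝ) / 2) ^ 2 / (((K : ℝ) + 1) * ((K : ℝ) + 1 + n)) < 1 := by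
    rw [← cast_bRatioQ]; exact_mod_cast hq
  have hb := besselI_mem_bracket n hx' K le_rfl hq'
  have et : ((bTailQ n x K : ℚ) : ℝ) = bTerm n (x : ℝ) K / (1 - ((x : ℝ) / 2) ^ 2 / (((K : ℝ) + 1) * ((K : ℝ) + 1 + n))) := by
    unfold bTailQ; push_cast; rw [cast_bTermQ, cast_bRatioQ]
  rw [cast_bPartialQ, et]
  exact hb

/-- ★ **Soundness of `besselICheck`**: `besselICheck n x lo hi K = true ⟹ lo ≤ I_n(x) ≤ hi`. [folklore] -/
theorem besselICheck_sound {n : ℕ} {x lo hi : ℚ} {K : ℕ} (h : besselICheck n x lo hi K = true) :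
    ((lo : ℚ) : ℝ) ≤ besselI n (x : ℝ) ∧ besselI n (x : ℝ) ≤ ((hi : ℚ) : ℝ) := by
  simp only [besselICheck, Bool.and_eq_true, decide_eq_true_eq] at h
  obtain ⟨⟨⟨hx, hq⟩, hlo⟩, hhi⟩ := h
  obtain ⟨h1, h2⟩ := bracket_cast n hx hq
  exact ⟨le_trans (by exact_mod_cast hlo) h1, h2.trans (by exact_mod_cast hhi)⟩

/-- ★ **Soundness of `besselRatioCheck`**: `besselRatioCheck n m x lo hi Kn Km = true ⟹ lo ≤ I_n(x)/I_m(x) ≤ hi`. [folklore] -/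
theorem besselRatioCheck_sound {n m : ℕ} {x lo hi : ℚ} {Kn Km : ℕ} (h : besselRatioCheck n m x lo hi Kn Km = true) :
    ((lo : ℚ) : ℝ) ≤ besselI n (x : ℝ) / besselI m (x : ℝ) ∧ besselI n (x : ℝ) / besselI m (x : ℝ) ≤ ((hi : ℚ) : ℝ) := by
  simp only [besselRatioCheck, Bool.and_eq_true, decide_eq_true_eq] at h
  obtain ⟨⟨⟨⟨⟨⟨⟨hx, hqn⟩, hqm⟩, hlo0⟩, hhi0⟩, hPm⟩, hlo⟩, hhi⟩ := h
  obtain ⟨hn1, hn2⟩ := bracket_cast n hx hqn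
  obtain ⟨hm1, hm2⟩ := bracket_cast m hx hqm
  have hPm' : (0 : ℝ) < ((bPartialQ m x Km : ℚ) : ℝ) := by exact_mod_cast hPm
  have hIm : 0 < besselI m (x : ℝ) := lt_of_lt_of_le hPm' hm1
  have hlo' : ((lo : ℚ) : ℝ) * (((bPartialQ m x Km : ℚ) : ℝ) + ((bTailQ m x Km : ℚ) : ℝ)) ≤ ((bPartialQ n x Kn : ℚ) : ℝ) := by
    exact_mod_cast hlo
  have hhi' : ((bPartialQ n x Kn : ℚ) : ℝ) + ((bTailQ n x Kn : ℚ) : ℝ) ≤ ((hi : ℚ) : ℝ) * ((bPartialQ m x Km : ℚ) : ℝ) := by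
    exact_mod_cast hhi
  have hlo0' : (0 : ℝ) ≤ ((lo : ℚ) : ℝ) := by exact_mod_cast hlo0
  have hhi0' : (0 : ℝ) ≤ ((hi : ℚ) : ℝ) := by exact_mod_cast hhi0
  constructor
  · rw [le_div_iff₀ hIm]
    calc ((lo : ℚ) : ℝ) * besselI m (x : ℝ)
        ≤ ((lo : ℚ) : ℝ) * (((bPartialQ m x Km : ℚ) : ℝ) + ((bTailQ m x Km : ℚ) : ℝ)) := mul_le_mul_of_nonneg_left hm2 hlo0'
      _ ≤ ((bPartialQ n x Kn : ℚ) : ℝ) := hlo'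
      _ ≤ besselI n (x : ℝ) := hn1
  · rw [div_le_iff₀ hIm]
    calc besselI n (x : ℝ) ≤ ((bPartialQ n x Kn : ℚ) : ℝ) + ((bTailQ n x Kn : ℚ) : ℝ) := hn2
      _ ≤ ((hi : ℚ) : ℝ) * ((bPartialQ m x Km : ℚ) : ℝ) := hhi'
      _ ≤ ((hi : ℚ) : ℝ) * besselI m (x : ℝ) := mul_le_mul_of_nonneg_left hm1 hhi0'

/-! ## §3 Sample rows: the character activities `v_j(β_W) = I_{2j+1}(β_W)/I₁(β_W)` at `β_W = 9/25` and `β_W = 1/10` -/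

/-- **`v_{1/2}(9/25) = u(0.36) = I₂/I₁ ∈ [89517902883, 89517902884]·10⁻¹²`** — agrees with the cos-moment route
(`StrongCouplingExpansionParameter.u1_encl_036`). [folklore] -/
theorem v_half_encl_036 :
    (89517902883 : ℝ) / 1000000000000 ≤ besselI 2 ((9 : ℝ) / 25) / besselI 1 ((9 : ℝ) / 25) ∧
      besselI 2 ((9 : ℝ) / 25) / besselI 1 ((9 : ℝ) / 25) ≤ (89517902884 : ℝ) / 1000000000000 := by
  have h := besselRatioCheck_sound (n := 2) (m := 1) (x := 9 / 25) (lo := 89517902883 / 1000000000000)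
    (hi := 89517902884 / 1000000000000) (Kn := 8) (Km := 8) (by decide +kernel)
  push_cast at h
  exact h

/-- **`v_1(9/25) = I₃/I₁ ∈ [lo, lo + 10⁻¹²]`**, `lo = 5356634626·10⁻¹²` (`≈ 0.0053566346`). [folklore] -/
theorem v_one_encl_036 :
    (5356634626 : ℝ) / 1000000000000 ≤ besselI 3 ((9 : ℝ) / 25) / besselI 1 ((9 : ℝ) / 25) ∧
      besselI 3 ((9 : ℝ) / 25) / besselI 1 ((9 : ℝ) / 25) ≤ (5356634627 : ℝ) / 1000000000000 := by
  have h := besselRatioCheck_sound (n := 3) (m := 1) (x := 9 / 25) (lo := 5356634626 / 1000000000000)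
    (hi := 5356634627 / 1000000000000) (Kn := 8) (Km := 8) (by decide +kernel)
  push_cast at h
  exact h

/-- **`v_{3/2}(9/25) = I₄/I₁ ∈ [lo, lo + 10⁻¹²]`**, `lo = 240659110·10⁻¹²` (`≈ 2.4066·10⁻⁴`). [folklore] -/
theorem v_threeHalves_encl_036 :
    (240659110 : ℝ) / 1000000000000 ≤ besselI 4 ((9 : ℝ) / 25) / besselI 1 ((9 : ℝ) / 25) ∧
      besselI 4 ((9 : ℝ) / 25) / besselI 1 ((9 : ℝ) / 25) ≤ (240659111 : ℝ) / 1000000000000 := by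
  have h := besselRatioCheck_sound (n := 4) (m := 1) (x := 9 / 25) (lo := 240659110 / 1000000000000)
    (hi := 240659111 / 1000000000000) (Kn := 8) (Km := 8) (by decide +kernel)
  push_cast at h
  exact h

/-- **`v_{1/2}(1/10) = u(0.1) = I₂/I₁ ∈ [24989589839, 24989589840]·10⁻¹²`** (= `StrongCouplingExpansionParameter.u1_encl_01`'s enclosure). [folklore] -/
theorem v_half_encl_01 :
    (24989589839 : ℝ) / 1000000000000 ≤ besselI 2 ((1 : ℝ) / 10) / besselI 1 ((1 : ℝ) / 10) ∧
      besselI 2 ((1 : ℝ) / 10) / besselI 1 ((1 : ℝ) / 10) ≤ (24989589840 : ℝ) / 1000000000000 := by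
  have h := besselRatioCheck_sound (n := 2) (m := 1) (x := 1 / 10) (lo := 24989589839 / 1000000000000)
    (hi := 24989589840 / 1000000000000) (Kn := 8) (Km := 8) (by decide +kernel)
  push_cast at h
  exact h

/-- **`v_1(1/10) = I₃/I₁ ∈ [416406423, 416406424]·10⁻¹²`** (`≈ 4.164·10⁻⁴ ≈ β_W²/24`). [folklore] -/
theorem v_one_encl_01 :
    (416406423 : ℝ) / 1000000000000 ≤ besselI 3 ((1 : ℝ) / 10) / besselI 1 ((1 : ℝ) / 10) ∧
      besselI 3 ((1 : ℝ) / 10) / besselI 1 ((1 : ℝ) / 10) ≤ (416406424 : ℝ) / 1000000000000 := by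
  have h := besselRatioCheck_sound (n := 3) (m := 1) (x := 1 / 10) (lo := 416406423 / 1000000000000)
    (hi := 416406424 / 1000000000000) (Kn := 8) (Km := 8) (by decide +kernel)
  push_cast at h
  exact h

/-- **`v_{3/2}(1/10) = I₄/I₁ ∈ [5204429, 5204430]·10⁻¹²`** (`≈ 5.20·10⁻⁶ ≈ β_W³/192`). [folklore] -/
theorem v_threeHalves_encl_01 :
    (5204429 : ℝ) / 1000000000000 ≤ besselI 4 ((1 : ℝ) / 10) / besselI 1 ((1 : ℝ) / 10) ∧
      besselI 4 ((1 : ℝ) / 10) / besselI 1 ((1 : ℝ) / 10) ≤ (5204430 : ℝ) / 1000000000000 := by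
  have h := besselRatioCheck_sound (n := 4) (m := 1) (x := 1 / 10) (lo := 5204429 / 1000000000000)
    (hi := 5204430 / 1000000000000) (Kn := 8) (Km := 8) (by decide +kernel)
  push_cast at h
  exact h

end Summit.QuantumFields.YangMills.Theorems.Instrument.BesselRatioEnclosures

end
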